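import Literature.Topology.FourManifolds.HomotopicCirclesIsotopic
import Literature.Topology.FourManifolds.DisjointSpheresSlab
import Literature.Topology.FourManifolds.HCobordismLevelSimplyConnected
import HarnessLib

/-!
# Milnor 1965, Thm. 8.1 at the incoming end: the target
# `Literature.Topology.FourManifolds.Cobordism.Milnor1965_exists_isMorseFunction_two_le_index_left`
# from the two leaves that remain named facts

Topic `Literature/Topology/FourManifolds` (fact seat
`provefact-Literature.Topology.FourManifolds.Cobord-98e969f2c0`).  With Thm. 4.4 on a slab
(`Cobordism.Milnor1965_exists_isGradientLike_disjoint_spheres_slab_holds`,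
`DisjointSpheresSlab.lean`), the embedded left-hand sphere
(`Cobordism.Milnor1965_leftHandSphere_embedded_holds`, `HCobordismAuxiliaryPairProofs.lean`),
`π₁(V₂₊) = 1` (`Cobordism.Milnor1965_simplyConnected_plusLevelTwo_holds`,
`HCobordismLevelSimplyConnected.lean`), Assertions 1–3 of the proof of Thm. 5.4
(`Cobordism.Milnor1965_cancellation_crossingField_holds`) and the isotopy of circles in the
simply connected level (`Milnor1965_isAmbientIsotopic_of_simplyConnected_holds`,
`HomotopicCirclesIsotopic.lean`) now theorems of the tree, Milnor's Thm. 8.1 at one end of the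
cobordism (proof on PDF pp. 54–57 of the held copy of *Lectures on the h-cobordism theorem*)
rests on exactly two named facts:

* `L3` — Assertion 6 of the proof of the First Cancellation Theorem 5.4
  (`Cobordism.Milnor1965_cancellation_preliminaryHypothesis`, `HCobordismFirstCancellation.lean`);
* `L8` — Lemma 8.3 with the translation to `V₂₊`
  (`Cobordism.Milnor1965_exists_idealCircle`, `HCobordismAuxiliaryPair.lean`).

This file records the corresponding reductions; everything here is proved.

## References

* J. Milnor, *Lectures on the h-cobordism theorem*, notes by L. Siebenmann and J. Sondow,
  Princeton Mathematical Notes (1965): Thm. 8.1 and its proof (PDF pp. 54–57), Thms. 4.4, 5.4,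
  Lemmas 8.2, 8.3, Thm. 8.4 and Remark, Thm. 5.8. [MilnorHCobordism1965]
-/

noncomputable section

namespace Literature.Topology.FourManifolds

universe u

/-- **The auxiliary pair of Milnor's proof of Thm. 8.1 Index 1 from Lemma 8.3 alone** (PDF
pp. 55–56): the named fact `Cobordism.Milnor1965_exists_auxiliaryPair` follows from
`Cobordism.Milnor1965_exists_idealCircle` (Lemma 8.3 with the translation to `V₂₊`), the
embedded left-hand sphere and `π₁(V₂₊) = 1` being theorems of the tree; by
`Cobordism.Milnor1965_exists_auxiliaryPair_of_three_leaves` (`HomotopicCirclesIsotopic.lean`).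
[cite: MilnorHCobordism1965, proof of Thm. 8.1 Index 1 (PDF pp. 55–56), Lemma 8.3] -/
theorem Cobordism.Milnor1965_exists_auxiliaryPair_of_idealCircle
    (hA : Cobordism.Milnor1965_exists_idealCircle.{u}) :
    Cobordism.Milnor1965_exists_auxiliaryPair.{u} :=
  Cobordism.Milnor1965_exists_auxiliaryPair_of_three_leaves hA
    Cobordism.Milnor1965_leftHandSphere_embedded_holds
    Cobordism.Milnor1965_simplyConnected_plusLevelTwo_holds

/-- **Milnor 1965, Thm. 8.1 at the incoming end, from the two leaves that remain named
facts**: the target `Cobordism.Milnor1965_exists_isMorseFunction_two_le_index_left` follows from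
Assertion 6 of the proof of Thm. 5.4 (`Cobordism.Milnor1965_cancellation_preliminaryHypothesis`)
and Lemma 8.3 (`Cobordism.Milnor1965_exists_idealCircle`), by
`Cobordism.Milnor1965_exists_isMorseFunction_two_le_index_left_of_five_leaves` with Thm. 4.4 on a
slab, the embedded left-hand sphere and `π₁(V₂₊) = 1` supplied by their discharges.
[cite: MilnorHCobordism1965, Thm. 8.1 and its proof (PDF pp. 54–57)] -/
theorem Cobordism.Milnor1965_exists_isMorseFunction_two_le_index_left_of_two_leaves
    (h6 : Cobordism.Milnor1965_cancellation_preliminaryHypothesis.{u})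
    (hA : Cobordism.Milnor1965_exists_idealCircle.{u}) :
    Cobordism.Milnor1965_exists_isMorseFunction_two_le_index_left.{u} :=
  Cobordism.Milnor1965_exists_isMorseFunction_two_le_index_left_of_five_leaves
    Cobordism.Milnor1965_exists_isGradientLike_disjoint_spheres_slab_holds h6 hA
    Cobordism.Milnor1965_leftHandSphere_embedded_holds
    Cobordism.Milnor1965_simplyConnected_plusLevelTwo_holds

end Literature.Topology.FourManifolds
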